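import Mathlib
import HarnessLib
import Summits.HubbardSuperconductivity.HubbardSuperconductivity.Theorems.KLProgrammeKLRegimeTwoVolumeLipGluedWt
import Summits.HubbardSuperconductivity.HubbardSuperconductivity.Theorems.KLProgrammeKLRegimeTwoVolumeLipDeepFirstOrder
import Summits.HubbardSuperconductivity.HubbardSuperconductivity.Theorems.KLProgrammeKLRegimeEngineTowerBlockIncrWt
import Summits.HubbardSuperconductivity.HubbardSuperconductivity.Theorems.KLProgrammeKLRegimeWickEffectiveActionLegDressing
import Summits.HubbardSuperconductivity.HubbardSuperconductivity.Theorems.KLProgrammeKLRegimeTwoVolumeFrameComposite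

/-!
# Route `KLProgramme` — crux K3 ENGINE (stmt-HubbardSuperconductivity-20437), stub (e) proof-input «(e)-D-ROWS», option (U) of DROWS-SCOPE-g23 v6 §9.5: THE BLOCK STEP
# OF THE TWO-VOLUME LIPSCHITZ TOWER AT A DEEP PIN IN THE UNWEIGHTED CURRENCY
# (seat hubbard-kl-k3c4-p1 g23; `--supports` 20437)

`…TwoVolumeLipBlockStepDeep.lipBlockStep_deep_le` (p704303) is the born-difference door at the model objects in E1's WEIGHTED track (tree weight `klGluedWt`,
admissible constant `Λ ≤ 1 + Λ_{dk−1}(R′+1)`), whereas the transfer doors of the chain (`…LipSourceTransfer`, `…LipRemeasure`, `…LipRemeasureSup`) produce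
UNWEIGHTED deep-pin / global profiles.  This file is the SAME door instantiated with the trivial tree weight `wt := 1` (`isTreeWeight_one`) and `Λ ≤ 1`: every
profile and every covariance row is now plain (`Σ‖·‖`), so the block step reads exactly the profiles the transfer doors deliver (`…LipDiffSups`); the price is
the loss of the `Λ⁻¹` gain on the non-near input (`Λ⁻¹ = Λ = 1` admissible).  Proof = p704303's, with the weight replaced.

* `lipBlockStep_deep_unweighted_le` — p704303's statement with unweighted `hNV`, `hND`, `hrow`, `hcol`, no `hNear`, and `0 < Λ ≤ 1`.

A composition of landed theorems; nothing asserts the (D) rows, stub (e), VL, K3 or superconductivity.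
References: BGM 2006 (2.77)–(2.90), §3 [cite: BenfattoGiulianiMastropietro2006]; Salmhofer 1998 §4.1.
-/

noncomputable section

namespace Summit.HubbardSuperconductivity.HubbardSuperconductivity.Theorems.TwoVolumeLip

set_option linter.dupNamespace false -- summit = problem name (single-conjunct summit), D-0017

open Finset Literature.MathematicalPhysics.QuantumLattice GrassmannAlgebra Literature.Probability.LatticeModels
  Literature.Probability.LatticeModels.BattleFederbush
open Literature.MathematicalPhysics.QuantumLattice.FermiRG
open Summit.HubbardSuperconductivity.HubbardSuperconductivity.Theorems.KLRegimeSplit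
open Summit.HubbardSuperconductivity.HubbardSuperconductivity.Theorems.KLProgrammeLegKernels
open Summit.HubbardSuperconductivity.HubbardSuperconductivity.Theorems.DispersionFlow
open Summit.HubbardSuperconductivity.HubbardSuperconductivity.Theorems.EngineV8
open Summit.HubbardSuperconductivity.HubbardSuperconductivity.Theorems.TwoVolumeSource
open Summit.HubbardSuperconductivity.HubbardSuperconductivity.Theorems.TwoVolumeDefect

variable {L b M : ℕ} [NeZero L] [NeZero (b * L)]

/-- **Option (U) — the block step at a deep pin, unweighted currency.**  p704303's `lipBlockStep_deep_le` with the trivial tree weight: the profiles `NV` (glued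
input), `ND` (input difference, global), `E` (input difference at `R`-deep pins) and the covariance rows `α` are PLAIN sums, `0 < Λ ≤ 1`; everything else
(parity / constant parts discharged, Gram bound `κ`, transfer rows `a`, near row / far tail `τ` w.r.t. `Near`, smallness `θ₁, θ₂`, truncation `N₀`) as there. -/
theorem lipBlockStep_deep_unweighted_le {β : ℝ} (U μ : ℝ) (K : TrigPolyC4v) {d k : ℕ}
    (hZf : hubbardEffPartitionFnCT (b * L) M β U μ 0 K (klScale klE0 (d * k)) ≠ 0)
    (hZc : hubbardEffPartitionFnCT L M β U μ 0 K (klScale klE0 (d * k)) ≠ 0)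
    {κ : ℝ} (hκ : 0 < κ) (hGB : IsGramBoundedR ((sectorSubMatrix (b * L) M β (bgmFatMultiplier (b * L) M klE0 β (nambuXiCT (b * L) μ K) (d * k - 1))).transpose * hubbardCovSliceCT (b * L) M β μ 0 K (klScale klE0 (d * (k + 1))) (klScale klE0 (d * k)) * sectorSubMatrix (b * L) M β (bgmFatMultiplier (b * L) M klE0 β (nambuXiCT (b * L) μ K) (d * k - 1))) κ)
    (NV ND E : ℕ → ℝ) (hNV0 : ∀ m', 0 ≤ NV m') (hND0 : ∀ m', 0 ≤ ND m') (hE0 : ∀ m', 0 ≤ E m')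
    (hNV : ∀ m' (j : Fin (2 * m')) (x : (SpaceTimeIdx (b * L) M × SectorLeg (sectorCount (d * k - 1)))), ∑ Y ∈ univ.filter (fun Y : Fin (2 * m') → (SpaceTimeIdx (b * L) M × SectorLeg (sectorCount (d * k - 1))) => Y j = x),
      ‖kernel ℂ (klGlue L b M (sectorCount (d * k - 1)) (klLipInput L M β U μ K d k)) (2 * m') Y‖ ≤ NV m')
    (hND : ∀ m' (j : Fin (2 * m')) (x : (SpaceTimeIdx (b * L) M × SectorLeg (sectorCount (d * k - 1)))), ∑ Y ∈ univ.filter (fun Y : Fin (2 * m') → (SpaceTimeIdx (b * L) M × SectorLeg (sectorCount (d * k - 1))) => Y j = x),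
      ‖kernel ℂ (klLipInputDiff L b M β U μ K d k) (2 * m') Y‖ ≤ ND m')
    (R : ℕ)
    (hE : ∀ m' (j : Fin (2 * m')) (x : (SpaceTimeIdx (b * L) M × SectorLeg (sectorCount (d * k - 1)))), x ∈ klDeepPins L R →
      ∑ Y ∈ univ.filter (fun Y : Fin (2 * m') → (SpaceTimeIdx (b * L) M × SectorLeg (sectorCount (d * k - 1))) => Y j = x), ‖kernel ℂ (klLipInputDiff L b M β U μ K d k) (2 * m') Y‖ ≤ E m')
    {α : ℝ} (hα : 0 < α)
    (hrow : ∀ X, ∑ Y, ‖((sectorSubMatrix (b * L) M β (bgmFatMultiplier (b * L) M klE0 β (nambuXiCT (b * L) μ K) (d * k - 1))).transpose * hubbardCovSliceCT (b * L) M β μ 0 K (klScale klE0 (d * (k + 1))) (klScale klE0 (d * k)) * sectorSubMatrix (b * L) M β (bgmFatMultiplier (b * L) M klE0 β (nambuXiCT (b * L) μ K) (d * k - 1))) X Y‖ ≤ α)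
    (hcol : ∀ Y, ∑ X, ‖((sectorSubMatrix (b * L) M β (bgmFatMultiplier (b * L) M klE0 β (nambuXiCT (b * L) μ K) (d * k - 1))).transpose * hubbardCovSliceCT (b * L) M β μ 0 K (klScale klE0 (d * (k + 1))) (klScale klE0 (d * k)) * sectorSubMatrix (b * L) M β (bgmFatMultiplier (b * L) M klE0 β (nambuXiCT (b * L) μ K) (d * k - 1))) X Y‖ ≤ α)
    {ρ : ℝ} (hρ : 0 < ρ)
    (hθ₁ : Real.exp 1 * α * normV (SpaceTimeIdx (b * L) M × SectorLeg (sectorCount (d * k - 1))) κ ρ (fun m' => NV m' + ND m' + E m') / κ ^ 2 < 1)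
    (hθ₂ : Real.exp 1 * α * normV (SpaceTimeIdx (b * L) M × SectorLeg (sectorCount (d * k - 1))) κ ρ (fun m' => NV m' + ND m') / κ ^ 2 < 1)
    {N₀ : ℕ} (hN₀ : 2 ≤ N₀)
    (Near : (SpaceTimeIdx (b * L) M × SectorLeg (sectorCount (d * k - 1))) → Prop) [DecidablePred Near]
    {a τ : ℝ} (ha : 0 ≤ a)
    (hcolH : ∀ y', ∑ x'', ‖(((((imagTimeWeight β M : ℝ) : ℂ)) • sectorAnalysisMatrix (b * L) M β (klAnisoFamily (b * L) M β μ K klE0 (d * k))) * sectorSubMatrix (b * L) M β (bgmFatMultiplier (b * L) M klE0 β (nambuXiCT (b * L) μ K) (d * k - 1))) x'' y'‖ ≤ a) (w'' : SpaceTimeIdx (b * L) M × SectorLeg (sectorCount (d * k)))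
    (hrowH : ∑ y' ∈ univ.filter (fun y' : (SpaceTimeIdx (b * L) M × SectorLeg (sectorCount (d * k - 1))) => Near y'), ‖(((((imagTimeWeight β M : ℝ) : ℂ)) • sectorAnalysisMatrix (b * L) M β (klAnisoFamily (b * L) M β μ K klE0 (d * k))) * sectorSubMatrix (b * L) M β (bgmFatMultiplier (b * L) M klE0 β (nambuXiCT (b * L) μ K) (d * k - 1))) w'' y'‖ ≤ a)
    (hτH : ∑ y' ∈ univ.filter (fun y' : (SpaceTimeIdx (b * L) M × SectorLeg (sectorCount (d * k - 1))) => ¬ Near y'), ‖(((((imagTimeWeight β M : ℝ) : ℂ)) • sectorAnalysisMatrix (b * L) M β (klAnisoFamily (b * L) M β μ K klE0 (d * k))) * sectorSubMatrix (b * L) M β (bgmFatMultiplier (b * L) M klE0 β (nambuXiCT (b * L) μ K) (d * k - 1))) w'' y'‖ ≤ τ)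
    {Λ : ℝ} (hΛ0 : 0 < Λ) (hΛle : Λ ≤ 1)
    {q : ℕ} (i : Fin (2 * q)) :
    ∑ X'' ∈ univ.filter (fun X'' : Fin (2 * q) → SpaceTimeIdx (b * L) M × SectorLeg (sectorCount (d * k)) => X'' i = w''),
        ‖kernel ℂ (ExteriorAlgebra.map (Matrix.toLin' ((((imagTimeWeight β M : ℝ) : ℂ)) • sectorAnalysisMatrix (b * L) M β (klAnisoFamily (b * L) M β μ K klE0 (d * k))))
          ((effAction ℂ (hubbardCovSliceCT (b * L) M β μ 0 K (klScale klE0 (d * (k + 1))) (klScale klE0 (d * k))) (ExteriorAlgebra.map (Matrix.toLin' (sectorSubMatrix (b * L) M β (bgmFatMultiplier (b * L) M klE0 β (nambuXiCT (b * L) μ K) (d * k - 1)))) (klLipInput (b * L) M β U μ K d k)) - ExteriorAlgebra.map (Matrix.toLin' (sectorSubMatrix (b * L) M β (bgmFatMultiplier (b * L) M klE0 β (nambuXiCT (b * L) μ K) (d * k - 1)))) (klLipInput (b * L) M β U μ K d k)) -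
            (effAction ℂ (hubbardCovSliceCT (b * L) M β μ 0 K (klScale klE0 (d * (k + 1))) (klScale klE0 (d * k))) (ExteriorAlgebra.map (Matrix.toLin' (sectorSubMatrix (b * L) M β (bgmFatMultiplier (b * L) M klE0 β (nambuXiCT (b * L) μ K) (d * k - 1)))) (klGlue L b M (sectorCount (d * k - 1)) (klLipInput L M β U μ K d k))) - ExteriorAlgebra.map (Matrix.toLin' (sectorSubMatrix (b * L) M β (bgmFatMultiplier (b * L) M klE0 β (nambuXiCT (b * L) μ K) (d * k - 1)))) (klGlue L b M (sectorCount (d * k - 1)) (klLipInput L M β U μ K d k))))) (2 * q) X''‖ ≤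
      a ^ (2 * q - 1) * (a *
        ((∑ m' ∈ range (Fintype.card (SpaceTimeIdx (b * L) M × SectorLeg (sectorCount (d * k - 1))) / 2 + 1), if q < m' then ((2 * m').choose (2 * q) : ℝ) * κ ^ (2 * m' - 2 * q) * E m' else 0) +
          Λ⁻¹ * ∑ m' ∈ range (Fintype.card (SpaceTimeIdx (b * L) M × SectorLeg (sectorCount (d * k - 1))) / 2 + 1),
            if q < m' then ((2 * m').choose (2 * q) : ℝ) * κ ^ (2 * m' - 2 * q) * ND m' else 0) +
        τ * ∑ m' ∈ range (Fintype.card (SpaceTimeIdx (b * L) M × SectorLeg (sectorCount (d * k - 1))) / 2 + 1), if q < m' then ((2 * m').choose (2 * q) : ℝ) * κ ^ (2 * m' - 2 * q) * ND m' else 0) +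
      a ^ (2 * q - 1) * (a *
        ((∑ n ∈ Ico 2 N₀, (ρ⁻¹ ^ (2 * q) * κ⁻¹ ^ (2 * (n - 1)) * (α ^ (n - 1) * Real.exp n)) *
            ∑ δ ∈ (Fintype.piFinset fun _ : Fin n => range (Fintype.card (SpaceTimeIdx (b * L) M × SectorLeg (sectorCount (d * k - 1))) / 2 + 1)) with 2 * q + 2 * (n - 1) ≤ ∑ a, 2 * δ a,
              ∑ a, (Real.exp 2 * (κ + ρ)) ^ (2 * δ a) * E (δ a) *
                ∏ b ∈ univ.erase a, (Real.exp 2 * (κ + ρ)) ^ (2 * δ b) * (NV (δ b) + ND (δ b) + E (δ b)) +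
          2 * (ρ⁻¹ ^ (2 * q) * (Real.exp 1 * normV (SpaceTimeIdx (b * L) M × SectorLeg (sectorCount (d * k - 1))) κ ρ (fun m' => NV m' + ND m' + E m')) *
            (Real.exp 1 * α * normV (SpaceTimeIdx (b * L) M × SectorLeg (sectorCount (d * k - 1))) κ ρ (fun m' => NV m' + ND m' + E m') / κ ^ 2) ^ (N₀ - 1) /
              (1 - Real.exp 1 * α * normV (SpaceTimeIdx (b * L) M × SectorLeg (sectorCount (d * k - 1))) κ ρ (fun m' => NV m' + ND m' + E m') / κ ^ 2))) +
        Λ⁻¹ * (∑ n ∈ Ico 2 N₀, (ρ⁻¹ ^ (2 * q) * κ⁻¹ ^ (2 * (n - 1)) * (α ^ (n - 1) * Real.exp n)) *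
            ∑ δ ∈ (Fintype.piFinset fun _ : Fin n => range (Fintype.card (SpaceTimeIdx (b * L) M × SectorLeg (sectorCount (d * k - 1))) / 2 + 1)) with 2 * q + 2 * (n - 1) ≤ ∑ a, 2 * δ a,
              ∑ a, (Real.exp 2 * (κ + ρ)) ^ (2 * δ a) * ND (δ a) *
                ∏ b ∈ univ.erase a, (Real.exp 2 * (κ + ρ)) ^ (2 * δ b) * (NV (δ b) + ND (δ b)) +
          Λ * (2 * (ρ⁻¹ ^ (2 * q) * (Real.exp 1 * normV (SpaceTimeIdx (b * L) M × SectorLeg (sectorCount (d * k - 1))) κ ρ (fun m' => NV m' + ND m')) *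
            (Real.exp 1 * α * normV (SpaceTimeIdx (b * L) M × SectorLeg (sectorCount (d * k - 1))) κ ρ (fun m' => NV m' + ND m') / κ ^ 2) ^ (N₀ - 1) /
              (1 - Real.exp 1 * α * normV (SpaceTimeIdx (b * L) M × SectorLeg (sectorCount (d * k - 1))) κ ρ (fun m' => NV m' + ND m') / κ ^ 2))))) +
        τ * (∑ n ∈ Ico 2 N₀, (ρ⁻¹ ^ (2 * q) * κ⁻¹ ^ (2 * (n - 1)) * (α ^ (n - 1) * Real.exp n)) *
            ∑ δ ∈ (Fintype.piFinset fun _ : Fin n => range (Fintype.card (SpaceTimeIdx (b * L) M × SectorLeg (sectorCount (d * k - 1))) / 2 + 1)) with 2 * q + 2 * (n - 1) ≤ ∑ a, 2 * δ a,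
              ∑ a, (Real.exp 2 * (κ + ρ)) ^ (2 * δ a) * ND (δ a) *
                ∏ b ∈ univ.erase a, (Real.exp 2 * (κ + ρ)) ^ (2 * δ b) * (NV (δ b) + ND (δ b)) +
          2 * (ρ⁻¹ ^ (2 * q) * (Real.exp 1 * normV (SpaceTimeIdx (b * L) M × SectorLeg (sectorCount (d * k - 1))) κ ρ (fun m' => NV m' + ND m')) *
            (Real.exp 1 * α * normV (SpaceTimeIdx (b * L) M × SectorLeg (sectorCount (d * k - 1))) κ ρ (fun m' => NV m' + ND m') / κ ^ 2) ^ (N₀ - 1) /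
              (1 - Real.exp 1 * α * normV (SpaceTimeIdx (b * L) M × SectorLeg (sectorCount (d * k - 1))) κ ρ (fun m' => NV m' + ND m') / κ ^ 2)))) := by
  classical
  -- parity and constant parts of the two inputs
  have hDLe : klLipInput L M β U μ K d k ∈ evenOdd ℂ 0 :=
    klLipInput_mem_evenOdd_zero (Summit.HubbardSuperconductivity.HubbardSuperconductivity.Theorems.KLRegimeWick.klEffectiveAction_mem_evenOdd_zero β U μ K klE0 (d * k))
  have hDL0 : constPart ℂ (klLipInput L M β U μ K d k) = 0 := by
    rw [constPart_klLipInput]; exact constPart_klEffectiveAction_eq_zero β U μ K klE0 (d * k) hZc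
  have hVe : klGlue L b M (sectorCount (d * k - 1)) (klLipInput L M β U μ K d k) ∈ evenPart ℂ (SpaceTimeIdx (b * L) M × SectorLeg (sectorCount (d * k - 1))) := klGlue_mem_evenOdd_zero hDLe
  have hV0 : constPart ℂ (klGlue L b M (sectorCount (d * k - 1)) (klLipInput L M β U μ K d k)) = 0 := constPart_klGlue hDL0
  have hDe : klLipInputDiff L b M β U μ K d k ∈ evenPart ℂ (SpaceTimeIdx (b * L) M × SectorLeg (sectorCount (d * k - 1))) :=
    klLipInputDiff_mem_evenOdd_zero
      (Summit.HubbardSuperconductivity.HubbardSuperconductivity.Theorems.KLRegimeWick.klEffectiveAction_mem_evenOdd_zero β U μ K klE0 (d * k))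
      (Summit.HubbardSuperconductivity.HubbardSuperconductivity.Theorems.KLRegimeWick.klEffectiveAction_mem_evenOdd_zero β U μ K klE0 (d * k))
  have hD0 : constPart ℂ (klLipInputDiff L b M β U μ K d k) = 0 :=
    constPart_klLipInputDiff (constPart_klEffectiveAction_eq_zero β U μ K klE0 (d * k) hZf) (constPart_klEffectiveAction_eq_zero β U μ K klE0 (d * k) hZc)
  -- the glued weight and the admissible constant
  have hwt : IsTreeWeight (fun _ : Finset (SpaceTimeIdx (b * L) M × SectorLeg (sectorCount (d * k - 1))) => (1 : ℝ)) := isTreeWeight_one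
  have hΛ : ∀ y', Near y' → ∀ Sset : Finset (SpaceTimeIdx (b * L) M × SectorLeg (sectorCount (d * k - 1))), y' ∈ Sset → (∃ z ∈ Sset, ¬ z ∈ klDeepPins L R) →
      Λ ≤ (fun _ : Finset (SpaceTimeIdx (b * L) M × SectorLeg (sectorCount (d * k - 1))) => (1 : ℝ)) Sset := fun _ _ _ _ _ => hΛle
  -- the substitutions
  set f : ((SpaceTimeIdx (b * L) M × SectorLeg (sectorCount (d * k - 1))) → ℂ) →ₗ[ℂ] (HubbardFieldIdx (b * L) M → ℂ) := Matrix.toLin' (sectorSubMatrix (b * L) M β (bgmFatMultiplier (b * L) M klE0 β (nambuXiCT (b * L) μ K) (d * k - 1))) with hf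
  set g : (HubbardFieldIdx (b * L) M → ℂ) →ₗ[ℂ] (SpaceTimeIdx (b * L) M × SectorLeg (sectorCount (d * k)) → ℂ) := Matrix.toLin' ((((imagTimeWeight β M : ℝ) : ℂ)) • sectorAnalysisMatrix (b * L) M β (klAnisoFamily (b * L) M β μ K klE0 (d * k))) with hg
  have hfm : LinearMap.toMatrix' f = sectorSubMatrix (b * L) M β (bgmFatMultiplier (b * L) M klE0 β (nambuXiCT (b * L) μ K) (d * k - 1)) := by rw [hf, LinearMap.toMatrix'_toLin']
  have hgf : LinearMap.toMatrix' (g ∘ₗ f) = ((((imagTimeWeight β M : ℝ) : ℂ)) • sectorAnalysisMatrix (b * L) M β (klAnisoFamily (b * L) M β μ K klE0 (d * k))) * sectorSubMatrix (b * L) M β (bgmFatMultiplier (b * L) M klE0 β (nambuXiCT (b * L) μ K) (d * k - 1)) := by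
    rw [LinearMap.toMatrix'_comp, hg, hf, LinearMap.toMatrix'_toLin', LinearMap.toMatrix'_toLin']
  have h := sum_pinned_norm_kernel_map_born_sub_born_le_of_deep hwt (hubbardCovSliceCT (b * L) M β μ 0 K (klScale klE0 (d * (k + 1))) (klScale klE0 (d * k))) f g hκ (by rw [hfm]; exact hGB)
    (klGlue L b M (sectorCount (d * k - 1)) (klLipInput L M β U μ K d k)) (klLipInputDiff L b M β U μ K d k) hVe hDe hV0 hD0 NV ND E hNV0 hND0 hE0 (fun m' j x => by simpa only [mul_one] using hNV m' j x)
    (fun m' j x => by simpa only [mul_one] using hND m' j x) (fun x => x ∈ klDeepPins L R) (fun m' j x hx => hE m' j x hx) hα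
    (by rw [hfm]; simpa only [mul_one] using hrow) (by rw [hfm]; simpa only [mul_one] using hcol) hρ hθ₁ hθ₂ hN₀ Near (a := a) (τ := τ) ha (by rw [hgf]; exact hcolH) w''
    (by rw [hgf]; exact hrowH) (by rw [hgf]; exact hτH) hΛ0 hΛ i
  rw [← klLipInput_fine_eq] at h
  exact h

end Summit.HubbardSuperconductivity.HubbardSuperconductivity.Theorems.TwoVolumeLip

end
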